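import Summits.HubbardSuperconductivity.HubbardSuperconductivity.Theorems.BalabanIRBirComplexStableXYRULEEquipartition
import HarnessLib

/-!
# Uniform local equipartition: two corollaries (line `log-concave-core-bounded-phase`, crux
# `BirComplexStableXYR`, stmt-HubbardSuperconductivity-14845; line lead a2)

* `ule_partZ_half_le` — the free-energy cost of halving the coupling is extensive and `K`-uniform:
  `Z(K/2) ≤ e^{C''|Λ|}·Z(K)`, `C'' = max(log(√(π³/c₀)/2), 0) + 3·max(B,0)` — the `S = Λ` case of the
  large-field tilt bound `stub_largeFieldTilt` of the line skeleton (from `ule_partZ_upper` and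
  `ule_partZ_lower`; the powers of `K` cancel);
* `ule_defect_density` — by (C) and Markov on `stub_uniformEquipartition`, the modulus-measure mass of
  the configurations in which a given pair of window sites is `η`-misaligned is `≤ C₃/(2c₀ηK)` times
  the total mass, uniformly in the volume: defects of the modulus measure are UNIFORMLY DILUTE for every
  admissible table. [folklore]
-/

noncomputable section

namespace Summit.HubbardSuperconductivity.HubbardSuperconductivity.Theorems

open MeasureTheory Set

section Corollaries

open Summit.HubbardSuperconductivity.BirComplexStableXYNegative Literature.Probability.LatticeModels

variable {r : ℕ}

/-- **Free-energy cost of halving the coupling is extensive and `K`-uniform.**  For an admissible table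
(`r ≥ 2`, (U1), (N), `normA ≤ B`, (C) with `c₀ > 0`) and `K ≥ 1`, on every torus
`Z(K/2) ≤ exp(C''·|Λ|)·Z(K)` with `C'' = max(log(√(π³/c₀)/2), 0) + 3·max(B, 0)`, where
`Z(κ) = ∫_cube exp(−κ Σ_s Re F(θ∘sh s)) dθ` — the `S = Λ` case of the large-field tilt bound
`stub_largeFieldTilt` (there `C₁ = e^{C''}`), from `ule_partZ_upper` and `ule_partZ_lower` (the powers of
`K` cancel). [folklore] -/
theorem ule_partZ_half_le (hr : 2 ≤ r) (c : Table r) (hU1 : ∀ n ∈ c.support, ∑ w, n w = 0)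
    (hN : c.sum (fun _ a => a) = 0) {B c₀ : ℝ} (hc₀ : 0 < c₀) (hA : normA c ≤ B)
    (hC : ∀ φ : W r → ℝ, c₀ * ∑ w, ∑ w', (1 - Real.cos (φ w - φ w')) ≤ (genF c φ).re)
    {K : ℝ} (hK : 1 ≤ K) (L M : ℕ) [NeZero L] [NeZero M] :
    ∫ θ in cube L M, Real.exp (-(K / 2 * ∑ s : Λ L M, (genF c (fun w => θ (sh L M s w))).re)) ≤
      Real.exp ((max (Real.log (Real.sqrt (Real.pi ^ 3 / c₀) / 2)) 0 + 3 * max B 0) * Fintype.card (Λ L M)) *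
        ∫ θ in cube L M, Real.exp (-(K * ∑ s : Λ L M, (genF c (fun w => θ (sh L M s w))).re)) := by
  have hK0 : 0 < K := by linarith
  set N : ℕ := Fintype.card (Λ L M) with hNdef
  have hN1 : 1 ≤ N := Fintype.card_pos_iff.mpr ⟨0⟩
  set D : ℝ := Real.sqrt (Real.pi ^ 3 / c₀) / 2 with hD
  have hDpos : 0 < D := by rw [hD]; positivity
  have hC0 : ∀ φ : W r → ℝ, 0 ≤ (genF c φ).re := fun φ =>
    le_trans (mul_nonneg hc₀.le (Finset.sum_nonneg fun _ _ => Finset.sum_nonneg fun _ _ =>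
      sub_nonneg.2 (Real.cos_le_one _))) (hC φ)
  have hZup := ule_partZ_upper hr c hc₀ hC (half_pos hK0) L M
  have hZlo := ule_partZ_lower c hU1 hN hA hC0 hK L M
  have hA_eq : Real.sqrt (Real.pi ^ 3 / (2 * (K / 2 * c₀))) = D * (2 * (Real.sqrt K)⁻¹) := by
    rw [hD]
    have hKc : 2 * (K / 2 * c₀) = K * c₀ := by ring
    rw [hKc, show Real.pi ^ 3 / (K * c₀) = (Real.pi ^ 3 / c₀) / K by field_simp,
      Real.sqrt_div' _ hK0.le]
    have hsK : 0 < Real.sqrt K := Real.sqrt_pos.mpr hK0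
    field_simp
  rw [hA_eq, mul_pow] at hZup
  -- `2π (2/√K)^{N-1} = e^{3B⁺N} · [2π (2/√K)^{N-1} e^{-3B⁺N}] ≤ e^{3B⁺N} Z(K)`
  have h1 : 2 * Real.pi * (D ^ (N - 1) * (2 * (Real.sqrt K)⁻¹) ^ (N - 1)) =
      D ^ (N - 1) * Real.exp (3 * max B 0 * N) *
        (2 * Real.pi * (2 * (Real.sqrt K)⁻¹) ^ (N - 1) * Real.exp (-(3 * max B 0 * N))) := by
    rw [Real.exp_neg]
    have : Real.exp (3 * max B 0 * N) ≠ 0 := (Real.exp_pos _).ne'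
    field_simp
  have h2 : D ^ (N - 1) ≤ Real.exp (max (Real.log D) 0 * N) := by
    have hlD : Real.log D ≤ max (Real.log D) 0 := le_max_left _ _
    have hm0 : 0 ≤ max (Real.log D) 0 := le_max_right _ _
    have hNr : ((N - 1 : ℕ) : ℝ) ≤ N := by exact_mod_cast Nat.sub_le N 1
    calc D ^ (N - 1) = Real.exp (Real.log D * (N - 1 : ℕ)) := by
          rw [← Real.rpow_natCast, Real.rpow_def_of_pos hDpos]
      _ ≤ Real.exp (max (Real.log D) 0 * N) := by
          apply Real.exp_le_exp.mpr
          rcases le_or_gt 0 (Real.log D) with h | h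
          · calc Real.log D * ((N - 1 : ℕ) : ℝ) ≤ Real.log D * N := mul_le_mul_of_nonneg_left hNr h
              _ ≤ max (Real.log D) 0 * N := mul_le_mul_of_nonneg_right hlD (by positivity)
          · have : Real.log D * ((N - 1 : ℕ) : ℝ) ≤ 0 :=
              mul_nonpos_of_nonpos_of_nonneg h.le (by positivity)
            have h' : 0 ≤ max (Real.log D) 0 * N := by positivity
            linarith
  calc ∫ θ in cube L M, Real.exp (-(K / 2 * ∑ s : Λ L M, (genF c (fun w => θ (sh L M s w))).re))
      ≤ 2 * Real.pi * (D ^ (N - 1) * (2 * (Real.sqrt K)⁻¹) ^ (N - 1)) := hZup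
    _ = D ^ (N - 1) * Real.exp (3 * max B 0 * N) *
        (2 * Real.pi * (2 * (Real.sqrt K)⁻¹) ^ (N - 1) * Real.exp (-(3 * max B 0 * N))) := h1
    _ ≤ Real.exp (max (Real.log D) 0 * N) * Real.exp (3 * max B 0 * N) *
        ∫ θ in cube L M, Real.exp (-(K * ∑ s : Λ L M, (genF c (fun w => θ (sh L M s w))).re)) := by
        gcongr
    _ = Real.exp ((max (Real.log D) 0 + 3 * max B 0) * N) *
        ∫ θ in cube L M, Real.exp (-(K * ∑ s : Λ L M, (genF c (fun w => θ (sh L M s w))).re)) := by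
        rw [← Real.exp_add]; congr 1; ring


/-- **Corollary: defects are uniformly dilute.**  Under the hypotheses of `stub_uniformEquipartition`
(with its `K₁, C₃`), for every `η > 0`, every window position `s` and every pair of window sites
`w, w'`, the modulus-measure mass of the configurations where that pair is `η`-misaligned
(`η ≤ 1 − cos(θ_{sh s w} − θ_{sh s w'})`) is at most `C₃/(2c₀ηK)` times the total mass — uniformly in
the volume: Markov's inequality on `Re F_s ≥ 2c₀(1 − cos(θ_{sh s w} − θ_{sh s w'}))` ((C), one pair of
the complete-window sum counted twice). [folklore] -/
theorem ule_defect_density :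
    ∀ (r : ℕ) (B c₀ : ℝ), 2 ≤ r → 0 < c₀ → ∃ K₁ C₃ : ℝ, ∀ K : ℝ, K₁ ≤ K → ∀ c : Table r, (∀ n ∈ c.support, ∑ w, n w = 0) → c.sum (fun _ a => a) = 0 → normA c ≤ B → (∀ φ : W r → ℝ, c₀ * ∑ w, ∑ w', (1 - Real.cos (φ w - φ w')) ≤ (genF c φ).re) → ∀ (L M : ℕ) [NeZero L] [NeZero M], ∀ (s : Λ L M) (w w' : W r) (η : ℝ), 0 < η → ∫ θ in cube L M, Set.indicator {θ | η ≤ 1 - Real.cos (θ (sh L M s w) - θ (sh L M s w'))} (fun _ => (1:ℝ)) θ * Real.exp (-(action K c L M θ).re) ≤ C₃ / (2 * c₀ * η * K) * ∫ θ in cube L M, Real.exp (-(action K c L M θ).re) := by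
  intro r B c₀ hr hc₀
  obtain ⟨K₁, C₃, H⟩ := stub_uniformEquipartition r B c₀ hr hc₀
  refine ⟨max K₁ 1, C₃, ?_⟩
  intro K hK c hU1 hN hA hC L M _ _ s w w' η hη
  have hK1 : K₁ ≤ K := le_trans (le_max_left _ _) hK
  have hK0 : 0 < K := lt_of_lt_of_le one_pos (le_trans (le_max_right _ _) hK)
  have hE := H K hK1 c hU1 hN hA hC L M s
  set wt : (Λ L M → ℝ) → ℝ := fun θ => Real.exp (-(action K c L M θ).re) with hwt
  set D : Set (Λ L M → ℝ) := {θ | η ≤ 1 - Real.cos (θ (sh L M s w) - θ (sh L M s w'))} with hD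
  -- pointwise: `2c₀η·𝟙_D ≤ Re F_s`
  have hpair : ∀ θ : Λ L M → ℝ, 2 * c₀ * (1 - Real.cos (θ (sh L M s w) - θ (sh L M s w'))) ≤
      (genF c (fun u => θ (sh L M s u))).re := by
    intro θ
    classical
    have hnn : ∀ u u' : W r, 0 ≤ 1 - Real.cos (θ (sh L M s u) - θ (sh L M s u')) := fun u u' =>
      sub_nonneg.2 (Real.cos_le_one _)
    have h2 : 2 * (1 - Real.cos (θ (sh L M s w) - θ (sh L M s w'))) ≤
        ∑ u : W r, ∑ u' : W r, (1 - Real.cos (θ (sh L M s u) - θ (sh L M s u'))) := by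
      by_cases hww : w = w'
      · subst hww
        simp only [sub_self, Real.cos_zero, mul_zero]
        exact Finset.sum_nonneg fun u _ => Finset.sum_nonneg fun u' _ => hnn u u'
      · rw [← Finset.sum_product' (f := fun u u' => 1 - Real.cos (θ (sh L M s u) - θ (sh L M s u')))]
        have hne : ((w, w') : W r × W r) ≠ (w', w) := fun h => hww (Prod.mk.inj h).1
        have key := Finset.add_le_sum (f := fun q : W r × W r =>
            1 - Real.cos (θ (sh L M s q.1) - θ (sh L M s q.2)))
          (fun q _ => hnn q.1 q.2) (Finset.mem_univ (w, w')) (Finset.mem_univ (w', w)) hne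
        have hsym : Real.cos (θ (sh L M s w') - θ (sh L M s w)) =
            Real.cos (θ (sh L M s w) - θ (sh L M s w')) := by rw [← Real.cos_neg]; ring_nf
        simp only [hsym] at key
        simpa [two_mul, Finset.univ_product_univ] using key
    have h3 := hC (fun u => θ (sh L M s u))
    nlinarith [h2, h3, hc₀]
  have hpt : ∀ θ : Λ L M → ℝ, (2 * c₀ * η) * (Set.indicator D (fun _ => (1:ℝ)) θ * wt θ) ≤
      (genF c (fun u => θ (sh L M s u))).re * wt θ := by
    intro θ
    have hw0 : 0 ≤ wt θ := (Real.exp_pos _).le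
    by_cases hθ : θ ∈ D
    · rw [Set.indicator_of_mem hθ, one_mul]
      have hθ' : η ≤ 1 - Real.cos (θ (sh L M s w) - θ (sh L M s w')) := hθ
      have := hpair θ
      have h1 : 2 * c₀ * η ≤ (genF c (fun u => θ (sh L M s u))).re := by nlinarith
      exact mul_le_mul_of_nonneg_right h1 hw0
    · rw [Set.indicator_of_notMem hθ, zero_mul, mul_zero]
      have := hpair θ
      have h0 : 0 ≤ (genF c (fun u => θ (sh L M s u))).re := by
        nlinarith [sub_nonneg.2 (Real.cos_le_one (θ (sh L M s w) - θ (sh L M s w'))), hc₀]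
      exact mul_nonneg h0 hw0
  -- integrate
  have hDmeas : MeasurableSet D := by
    have : D = (fun θ : Λ L M → ℝ => 1 - Real.cos (θ (sh L M s w) - θ (sh L M s w'))) ⁻¹' Set.Ici η := by
      ext θ; simp [hD]
    rw [this]
    refine (Continuous.measurable ?_) measurableSet_Ici
    exact continuous_const.sub (Real.continuous_cos.comp ((continuous_apply _).sub (continuous_apply _)))
  have hint_F := ule_integrable_mul_weight hK0.le hc₀.le c hC L M _ (ule_continuous_re_genF_sh c L M s)
    (normA c) (fun θ => (Complex.abs_re_le_norm _).trans (ule_norm_genF_le c _))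
  have hint_w : Integrable wt (volume.restrict (cube L M)) := by
    simpa using ule_integrable_mul_weight hK0.le hc₀.le c hC L M (fun _ => (1:ℝ)) continuous_const 1
      (fun _ => by simp)
  have hint_ind : Integrable (fun θ => Set.indicator D (fun _ => (1:ℝ)) θ * wt θ) (volume.restrict (cube L M)) := by
    have : (fun θ => Set.indicator D (fun _ => (1:ℝ)) θ * wt θ) = Set.indicator D wt := by
      funext θ; by_cases h : θ ∈ D <;> simp [h]
    rw [this]
    exact hint_w.indicator hDmeas
  have hI : (2 * c₀ * η) * ∫ θ in cube L M, Set.indicator D (fun _ => (1:ℝ)) θ * wt θ ≤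
      ∫ θ in cube L M, (genF c (fun u => θ (sh L M s u))).re * wt θ := by
    rw [← integral_const_mul]
    exact integral_mono (hint_ind.const_mul _) hint_F hpt
  have hpos : 0 < 2 * c₀ * η := by positivity
  have h1 : ∫ θ in cube L M, Set.indicator D (fun _ => (1:ℝ)) θ * wt θ ≤
      (1 / (2 * c₀ * η)) * ∫ θ in cube L M, (genF c (fun u => θ (sh L M s u))).re * wt θ := by
    rw [one_div, ← div_eq_inv_mul, le_div_iff₀ hpos, mul_comm]
    exact hI
  have hZ0 : 0 ≤ ∫ θ in cube L M, wt θ := integral_nonneg fun θ => (Real.exp_pos _).le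
  calc ∫ θ in cube L M, Set.indicator D (fun _ => (1:ℝ)) θ * wt θ
      ≤ (1 / (2 * c₀ * η)) * ∫ θ in cube L M, (genF c (fun u => θ (sh L M s u))).re * wt θ := h1
    _ ≤ (1 / (2 * c₀ * η)) * (C₃ / K * ∫ θ in cube L M, wt θ) :=
        mul_le_mul_of_nonneg_left hE (by positivity)
    _ = C₃ / (2 * c₀ * η * K) * ∫ θ in cube L M, wt θ := by
        field_simp

end Corollaries

end Summit.HubbardSuperconductivity.HubbardSuperconductivity.Theorems

end
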